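import Literature.Probability.LatticeModels.CriticalWickDichotomy
import Literature.Probability.LatticeModels.GaussianPairingBound
import Summits.CriticalPhenomena.Ising3DConformalLimit.Theses.HyperoctahedralRP
import HarnessLib

/-!
# Gaussian domination in the scaling limit of the critical `ℤ³` correlators: stub
# `stub_gaussianDomination` of line `free-endpoint-gaussian-closure` for crux
# `InversionUpgradeNormalised` (stmt-CriticalPhenomena-1982)

Statement.  Let `S` be a pointwise scaling limit (`HasPointwiseScalingLimit`) of the critical Ising
correlators `criticalCorr 3` on `ℤ³` under a renormalisation `ρ` (positive on `(0,1]`; positivity is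
not used).  Then for every `n` and every non-coincident configuration `x : Fin (2n) → ℝ³` the
`2n`-point function is dominated by the Wick pairing sum of the two-point function,
`S_{2n}(x) ≤ 𝒢_n[S₂](x) = pairingSum (fun a b => S 2 ![a, b]) n x`.

Proof (Newman 1975 / Aizenman 1982, Prop. 12.1, lower half; Aizenman–Duminil-Copin 2021, §6.3,
first display — passed to the scaling limit).
* LATTICE: Newman's Gaussian inequality for the critical state in infinite volume,
  `⟨∏_{i<2n} σ_{yᵢ}⟩_{β_c} ≤ 𝒢_n[⟨σσ⟩_{β_c}](y)` for every `y : Fin (2n) → ℤ³` (coincidences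
  allowed): for `n ≥ 2` the box limit (free boundary condition, `criticalCorr_wellDefined_holds`,
  `tendsto_pairingSum`, `eventually_forall_mem_box`) of the tree's finite-volume theorem
  `aizenman_nPoint_le_pairingSum_finite_holds`; `n = 1` is `𝒢₁[S₂](a,b) = S₂(a,b)` (`pairingSum_one`,
  symmetry `criticalCorr_two_pair_comm`), `n = 0` is `⟨1⟩ ≤ 1 = 𝒢₀` (`pairingSum_zero`,
  `abs_criticalCorr_le_one`).  (The same inequality is the tree lemma
  `MoebiusLimitExistsOnlyInteraction.criticalCorr_le_pairingSum` of
  `Theorems/EnergyNotSigmaSquaredMoebiusLimitExistsLocallyBounded.lean`; it is re-derived inside the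
  proof of `rescaledCorrelator_le_pairingSum_index` to keep this line's import closure free of the
  pinned-zoom machinery of that file.)
* SCALING: at mesh `δ`, multiply by `ρ(δ)^{2n} = (ρ(δ)²)ⁿ ≥ 0` and read the pairing functional at the
  level of INDICES (`PairIsing.pairingSum_eq_pow_mul`: every pairing uses `n` pairs of DISTINCT
  indices, so the diagonal entries may be set to `0`): the rescaled `2n`-point correlator at
  `[x/δ]` is at most the pairing functional of the index kernel
  `T_δ(i,j) = ρ(δ)² ⟨σ_{[xᵢ/δ]} σ_{[xⱼ/δ]}⟩_{β_c}` (`i ≠ j`), which is the rescaled pair correlator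
  at the non-coincident pair `(xᵢ, xⱼ)`.
* LIMIT `δ → 0⁺`: the left side tends to `S_{2n}(x)` and every entry `T_δ(i,j)`, `i ≠ j`, to
  `S₂(xᵢ, xⱼ)` (`TendstoLocallyUniformlyOn.tendsto_at` at non-coincident configurations only), hence
  the pairing functional of `T_δ` to that of the limit kernel (`tendsto_pairingSum`, a polynomial in
  finitely many entries); `le_of_tendsto_of_tendsto'` and the index-level identity read backwards.

References: C. M. Newman, Z. Wahrsch. verw. Gebiete 33 (1975) 75–93 (Gaussian inequality);
M. Aizenman, Comm. Math. Phys. 86 (1982) 1–48, Prop. 12.1; M. Aizenman, H. Duminil-Copin,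
Ann. Math. 194 (2021), §6.3, first display (lower inequality). No definitions are introduced.
-/

noncomputable section

open Filter Topology MeasureTheory
open Literature.Probability.LatticeModels

namespace Summit.CriticalPhenomena.Ising3DConformalLimit.Cruxes.InversionUpgradeNormalised.FreeEndpointGaussianClosure

/-! ### The rescaled lattice inequality at mesh `δ`, at the level of indices -/

/-- **Rescaled Gaussian domination at mesh `δ`, index form.**  For every configuration
`x : Fin (2n) → ℝ³`, every mesh `δ` and every renormalisation `ρ`,
`ρ(δ)^{2n} ⟨∏ σ_{[xᵢ/δ]}⟩_{β_c} ≤ 𝒢_n[T_δ](id)` with the index kernel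
`T_δ(i,j) = ρ(δ)² ⟨σ_{[xᵢ/δ]}σ_{[xⱼ/δ]}⟩_{β_c}` off the diagonal (any values on it): Newman's
Gaussian inequality for the critical state in infinite volume,
`⟨∏_{i<2n} σ_{zᵢ}⟩_{β_c} ≤ 𝒢_n[⟨σσ⟩_{β_c}](z)` (box limit, free boundary condition, of
`aizenman_nPoint_le_pairingSum_finite_holds` for `n ≥ 2`; `n ≤ 1` direct), multiplied by
`(ρ(δ)²)ⁿ ≥ 0`, and `PairIsing.pairingSum_eq_pow_mul`. -/
theorem rescaledCorrelator_le_pairingSum_index (ρ : ℝ → ℝ) {n : ℕ} (δ : ℝ)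
    (x : Fin (2 * n) → EuclideanSpace ℝ (Fin 3)) (T : Fin (2 * n) → Fin (2 * n) → ℝ)
    (hT : ∀ i j, i ≠ j →
      T i j = rescaledCorrelator (criticalCorr 3) ρ 2 δ ![x i, x j]) :
    rescaledCorrelator (criticalCorr 3) ρ (2 * n) δ x ≤ pairingSum T n id := by
  classical
  set z : Fin (2 * n) → Site 3 := fun i => latticeApprox δ (x i) with hz
  -- Newman's Gaussian inequality for the critical state at the lattice points `z`
  have hlat : criticalCorr 3 (2 * n) z ≤ pairingSum (fun a b => criticalCorr 3 2 ![a, b]) n z := by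
    -- adapted from Theorems/EnergyNotSigmaSquaredMoebiusLimitExistsLocallyBounded.lean
    -- `criticalCorr_le_pairingSum`
    rcases Nat.lt_or_ge n 2 with hn | hn
    · clear_value z
      interval_cases n
      · rw [pairingSum_zero]
        exact (le_abs_self _).trans (abs_criticalCorr_le_one le_rfl _ _)
      · rw [pairingSum_one _ fun a b => criticalCorr_two_pair_comm a b]
        apply le_of_eq
        show plusExpect 3 (criticalBeta 3) 0 (spinMonomial z) =
          plusExpect 3 (criticalBeta 3) 0 (spinMonomial ![z 0, z 1])
        congr 1
    · have hmem : (BoundaryCondition.free : BoundaryCondition (Site 3)) ∈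
          ({.free, .plus, .minus} : Set (BoundaryCondition (Site 3))) := by simp
      have hN : Tendsto (fun L : ℕ => nPoint (isingMeasure (zdGraph 3) (box 3 L) (criticalBeta 3) 0
          .free) spinAt z) atTop (𝓝 (criticalCorr 3 (2 * n) z)) :=
        criticalCorr_wellDefined_holds (d := 3) le_rfl (2 * n) z .free hmem
      have h2 : ∀ a b : Site 3, Tendsto (fun L : ℕ => twoPoint (isingMeasure (zdGraph 3) (box 3 L)
          (criticalBeta 3) 0 .free) spinAt a b) atTop (𝓝 (criticalCorr 3 2 ![a, b])) := by
        intro a b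
        refine Tendsto.congr (fun L => ?_)
          (criticalCorr_wellDefined_holds (d := 3) le_rfl 2 ![a, b] .free hmem)
        simp only [twoPoint, isingExpect, spinMonomial, Fin.prod_univ_two, Matrix.cons_val_zero,
          Matrix.cons_val_one]
      refine le_of_tendsto_of_tendsto hN (tendsto_pairingSum h2 n z) ?_
      filter_upwards [eventually_forall_mem_box z] with L hL
      exact aizenman_nPoint_le_pairingSum_finite_holds (box 3 L) (criticalBeta 3)
        (criticalBeta_nonneg 3) n hn z hL
  -- index-level rescaling identity
  have hP : pairingSum T n id = (ρ δ ^ 2) ^ n *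
      pairingSum (fun a b => criticalCorr 3 2 ![a, b]) n z :=
    PairIsing.pairingSum_eq_pow_mul (fun a b => criticalCorr 3 2 ![a, b]) T (ρ δ ^ 2) n z id
      fun i j hij => by
        rw [id, id, hT i j hij, rescaledCorrelator_apply, latticeApprox_comp_two]
        rfl
  have hc : 0 ≤ (ρ δ ^ 2) ^ n := pow_nonneg (sq_nonneg _) n
  rw [hP, rescaledCorrelator_apply, pow_mul]
  exact mul_le_mul_of_nonneg_left hlat hc

/-! ### The registered stub -/

/-- **stub_gaussianDomination** (Gaussian domination in the scaling limit; Newman 1975, Aizenman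
1982 Prop. 12.1 lower half, Aizenman–Duminil-Copin 2021 §6.3 first display).  For every pointwise
scaling limit `S` of `criticalCorr 3` (renormalisation `ρ > 0` on `(0,1]`), every `n` and every
non-coincident `x : Fin (2n) → ℝ³`, `S_{2n}(x) ≤ 𝒢_n[S₂](x)`.  The rescaled lattice inequality
(`rescaledCorrelator_le_pairingSum_index`) is passed to the limit `δ → 0⁺` entrywise at the
non-coincident pairs `(xᵢ, xⱼ)`, `i ≠ j` (`tendsto_pairingSum`, `le_of_tendsto_of_tendsto'`), and
the index kernel of the limit is read back at the level of points (`PairIsing.pairingSum_eq_pow_mul`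
with ratio `1`). -/
theorem stub_gaussianDomination :
    ∀ (ρ : ℝ → ℝ) (S : CorrFamily 3), (∀ δ ∈ Set.Ioc (0:ℝ) 1, 0 < ρ δ) →
      HasPointwiseScalingLimit (criticalCorr 3) ρ S →
      ∀ (n : ℕ) (x : Fin (2 * n) → EuclideanSpace ℝ (Fin 3)), x ∈ NonCoincident 3 (2 * n) →
        S (2 * n) x ≤ pairingSum (fun a b => S 2 ![a, b]) n x := by
  intro ρ S _hρ hlim n x hx
  classical
  have hinj : Function.Injective x := hx
  -- the rescaled pair kernel at the level of indices (diagonal zeroed) and its limit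
  set T : ℝ → Fin (2 * n) → Fin (2 * n) → ℝ := fun δ i j =>
      if i = j then 0 else rescaledCorrelator (criticalCorr 3) ρ 2 δ ![x i, x j] with hT
  set T₀ : Fin (2 * n) → Fin (2 * n) → ℝ := fun i j =>
      if i = j then 0 else S 2 ![x i, x j] with hT₀
  -- (1) the rescaled lattice inequality at every mesh
  have hineq : ∀ δ, rescaledCorrelator (criticalCorr 3) ρ (2 * n) δ x ≤ pairingSum (T δ) n id :=
    fun δ => rescaledCorrelator_le_pairingSum_index ρ δ x (T δ) fun i j hij => by
      simp only [hT, if_neg hij]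
  -- (2) entrywise limits along `δ → 0⁺`
  have hTlim : ∀ i j, Tendsto (fun δ => T δ i j) (𝓝[>] 0) (𝓝 (T₀ i j)) := by
    intro i j
    by_cases hij : i = j
    · simp only [hT, hT₀, if_pos hij]
      exact tendsto_const_nhds
    · simp only [hT, hT₀, if_neg hij]
      exact (hlim 2).tendsto_at (pair_mem_nonCoincident fun h => hij (hinj h))
  -- (3) passage to the limit
  have hle : S (2 * n) x ≤ pairingSum T₀ n id :=
    le_of_tendsto_of_tendsto' ((hlim (2 * n)).tendsto_at hx) (tendsto_pairingSum hTlim n id) hineq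
  -- (4) back to the point-level pairing functional
  rwa [PairIsing.pairingSum_eq_pow_mul (fun p q => S 2 ![p, q]) T₀ 1 n x id (fun i j hij => by
    simp only [hT₀, id, if_neg hij, one_mul]), one_pow, one_mul] at hle

end Summit.CriticalPhenomena.Ising3DConformalLimit.Cruxes.InversionUpgradeNormalised.FreeEndpointGaussianClosure

end
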